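import Literature.Computability.QuantumComplexity.ZXCalculus
import HarnessLib

/-!
# `ZX_{π/4}`: inter-derivability is a congruence; symmetries of derivations; casts

Topic `Literature/Computability/QuantumComplexity`, continuing `ZXCalculus.lean` (the term calculus
`ZXDiagram`, the rule table `ZXDiagram.Rule`, one-step rewriting `ZXStep`, derivations
`ZXDerivation`/`ZXDerives`, and `ZXEquivalent D D'` = "`ZX_{π/4} ⊢ D = D'`"). This is layer A1 of the
formalisation of the completeness theorem of Jeandel–Perdrix–Vilmart (the named fact
`JeandelPerdrixVilmart2018_completeness`): the equational-logic layer that every later derivation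
uses, namely

* `ZXDerivation.map`: a derivation is transported through any step-preserving map of diagrams, with the
  same length (`length_map`); hence rewriting inside the four one-hole contexts `· ⨾ B`, `A ⨾ ·`,
  `· ⊗ B`, `A ⊗ ·` (JPV §2.2: "apply the axioms to sub-diagrams") at the level of `ZXDerives`
  (length-preserving: `ZXDerives.seq_left` …) and of `ZXEquivalent` (`seq_congr`, `par_congr`);
* `ZXEquivalent` is an equivalence relation (`refl`, `symm`, `trans`, a `Setoid` and `Trans`
  instances for `calc`), contains every rule in both directions (`ZXDiagram.Rule.zx`, `Rule.zx_symm`);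
  scoped notation `D ⇌ D'`;
* the two symmetries of the rule table act on derivations: `ZXStep.transpose`, `ZXStep.colorSwap`,
  the involutions `transpose_transpose`, `colorSwap_colorSwap`, and
  `ZXEquivalent.transpose_iff`, `ZXEquivalent.colorSwap_iff` (JPV, caption of Fig. 1 and §10: "for any
  provable equation, its upside down version, its colour-swapped version … are all provable");
* transport along `ZXDiagram.cast` (equal wire counts): `ZXStep.cast`, `ZXEquivalent.cast_iff`,
  and the algebra of casts (`cast_cast`, `cast_seq_cast`, `cast_par_cast`, `transpose_cast`).

## References

* E. Jeandel, S. Perdrix, R. Vilmart, *A complete axiomatisation of the ZX-calculus for Clifford+T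
  quantum mechanics*, LICS 2018 (arXiv:1705.11151v2), §2.2 (the calculus: axioms applied to
  sub-diagrams; colour-swapping preserves equalities), Fig. 1 caption, §10 [JeandelPerdrixVilmart2018].
* P. Selinger, *A survey of graphical languages for monoidal categories* (2010), §3 [Selinger2010].

Not here: derived equations of the calculus (structural and spider lemmas: layers A2/A3, sibling
files); soundness of the rules.
-/

noncomputable section

namespace Literature.Computability.QuantumComplexity

open ZXDiagram

variable {n m k n' m' n'' m'' : ℕ}

/-! ### Syntactic involutions: `transpose` and `colorSwap` -/

namespace ZXDiagram

/-- `transpose` of a sequential composition (definitional). [cite: JeandelPerdrixVilmart2018, Fig. 1] -/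
@[simp] theorem transpose_seq (A : ZXDiagram n m) (B : ZXDiagram m k) :
    (A ⨾ B).transpose = B.transpose ⨾ A.transpose := rfl

/-- `transpose` of a spatial composition (definitional). [cite: JeandelPerdrixVilmart2018, Fig. 1] -/
@[simp] theorem transpose_par (A : ZXDiagram n m) (B : ZXDiagram n' m') :
    (A ⊗ B).transpose = A.transpose ⊗ B.transpose := rfl

/-- `transpose` fixes identities. [folklore] -/
@[simp] theorem transpose_wires (n : ℕ) : (wires n).transpose = wires n := rfl
/-- `transpose` fixes the crossing. [folklore] -/
@[simp] theorem transpose_swap : swap.transpose = swap := rfl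
/-- `transpose` exchanges cup and cap. [folklore] -/
@[simp] theorem transpose_cup : cup.transpose = cap := rfl
/-- `transpose` exchanges cap and cup. [folklore] -/
@[simp] theorem transpose_cap : cap.transpose = cup := rfl
/-- `transpose` fixes the Hadamard box. [folklore] -/
@[simp] theorem transpose_hBox : hBox.transpose = hBox := rfl
/-- `transpose` of a green spider exchanges inputs and outputs. [folklore] -/
@[simp] theorem transpose_Z (n m : ℕ) (a : ZMod 8) : (Z n m a).transpose = Z m n a := rfl
/-- `transpose` of a red spider exchanges inputs and outputs. [folklore] -/
@[simp] theorem transpose_X (n m : ℕ) (a : ZMod 8) : (X n m a).transpose = X m n a := rfl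

/-- The upside-down flip is an involution on terms. [folklore] -/
@[simp] theorem transpose_transpose : {n m : ℕ} → (D : ZXDiagram n m) → D.transpose.transpose = D
  | _, _, wires _ => rfl
  | _, _, swap => rfl
  | _, _, cup => rfl
  | _, _, cap => rfl
  | _, _, hBox => rfl
  | _, _, Z _ _ _ => rfl
  | _, _, X _ _ _ => rfl
  | _, _, seq A B => by rw [transpose_seq, transpose_seq, transpose_transpose A, transpose_transpose B]
  | _, _, par A B => by rw [transpose_par, transpose_par, transpose_transpose A, transpose_transpose B]

/-- `colorSwap` of a sequential composition (definitional). [cite: JeandelPerdrixVilmart2018, Fig. 1] -/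
@[simp] theorem colorSwap_seq (A : ZXDiagram n m) (B : ZXDiagram m k) :
    (A ⨾ B).colorSwap = A.colorSwap ⨾ B.colorSwap := rfl

/-- `colorSwap` of a spatial composition (definitional). [cite: JeandelPerdrixVilmart2018, Fig. 1] -/
@[simp] theorem colorSwap_par (A : ZXDiagram n m) (B : ZXDiagram n' m') :
    (A ⊗ B).colorSwap = A.colorSwap ⊗ B.colorSwap := rfl

/-- `colorSwap` fixes identities. [folklore] -/
@[simp] theorem colorSwap_wires (n : ℕ) : (wires n).colorSwap = wires n := rfl
/-- `colorSwap` fixes the crossing. [folklore] -/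
@[simp] theorem colorSwap_swap : swap.colorSwap = swap := rfl
/-- `colorSwap` fixes the cup. [folklore] -/
@[simp] theorem colorSwap_cup : cup.colorSwap = cup := rfl
/-- `colorSwap` fixes the cap. [folklore] -/
@[simp] theorem colorSwap_cap : cap.colorSwap = cap := rfl
/-- `colorSwap` fixes the Hadamard box. [folklore] -/
@[simp] theorem colorSwap_hBox : hBox.colorSwap = hBox := rfl
/-- `colorSwap` turns green into red. [folklore] -/
@[simp] theorem colorSwap_Z (n m : ℕ) (a : ZMod 8) : (Z n m a).colorSwap = X n m a := rfl
/-- `colorSwap` turns red into green. [folklore] -/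
@[simp] theorem colorSwap_X (n m : ℕ) (a : ZMod 8) : (X n m a).colorSwap = Z n m a := rfl

/-- The colour swap is an involution on terms. [folklore] -/
@[simp] theorem colorSwap_colorSwap : {n m : ℕ} → (D : ZXDiagram n m) → D.colorSwap.colorSwap = D
  | _, _, wires _ => rfl
  | _, _, swap => rfl
  | _, _, cup => rfl
  | _, _, cap => rfl
  | _, _, hBox => rfl
  | _, _, Z _ _ _ => rfl
  | _, _, X _ _ _ => rfl
  | _, _, seq A B => by rw [colorSwap_seq, colorSwap_seq, colorSwap_colorSwap A, colorSwap_colorSwap B]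
  | _, _, par A B => by rw [colorSwap_par, colorSwap_par, colorSwap_colorSwap A, colorSwap_colorSwap B]

/-! ### The algebra of casts -/

/-- Casts compose. [folklore] -/
@[simp] theorem cast_cast (D : ZXDiagram n m) (hn : n = n') (hm : m = m') (hn' : n' = n'')
    (hm' : m' = m'') : (D.cast hn hm).cast hn' hm' = D.cast (hn.trans hn') (hm.trans hm') := by
  subst hn hm hn' hm'; rfl

/-- A cast of a sequential composition is the composition of casts of the factors (the middle wire
count being cast arbitrarily). [folklore] -/
theorem cast_seq_cast (A : ZXDiagram n m) (B : ZXDiagram m k) (hn : n = n') (hm : m = m')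
    (hk : k = n'') : A.cast hn hm ⨾ B.cast hm hk = (A ⨾ B).cast hn hk := by
  subst hn hm hk; rfl

/-- A spatial composition of casts is a cast. [folklore] -/
theorem cast_par_cast (A : ZXDiagram n m) (B : ZXDiagram n' m') {p q p' q' : ℕ} (hn : n = p)
    (hm : m = q) (hn' : n' = p') (hm' : m' = q') :
    A.cast hn hm ⊗ B.cast hn' hm' = (A ⊗ B).cast (by rw [hn, hn']) (by rw [hm, hm']) := by
  subst hn hm hn' hm'; rfl

/-- Casts commute with the upside-down flip. [folklore] -/
theorem transpose_cast (D : ZXDiagram n m) (hn : n = n') (hm : m = m') :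
    (D.cast hn hm).transpose = D.transpose.cast hm hn := by
  subst hn hm; rfl

/-- Casts commute with the colour swap. [folklore] -/
theorem colorSwap_cast (D : ZXDiagram n m) (hn : n = n') (hm : m = m') :
    (D.cast hn hm).colorSwap = D.colorSwap.cast hn hm := by
  subst hn hm; rfl

end ZXDiagram

/-! ### Steps under the symmetries and under casts -/

namespace ZXStep

variable {D E : ZXDiagram n m}

/-- The upside-down flip of a rewrite step is a rewrite step (the rule table is closed under
`transpose`, and contexts flip). [cite: JeandelPerdrixVilmart2018, Fig. 1] -/
theorem transpose (h : ZXStep D E) : ZXStep D.transpose E.transpose := by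
  induction h with
  | rule h => exact .rule h.transpose
  | rule_symm h => exact .rule_symm h.transpose
  | seq_left B _ ih => exact .seq_right B.transpose ih
  | seq_right A _ ih => exact .seq_left A.transpose ih
  | par_left B _ ih => exact .par_left B.transpose ih
  | par_right A _ ih => exact .par_right A.transpose ih

/-- The colour swap of a rewrite step is a rewrite step. [cite: JeandelPerdrixVilmart2018, Fig. 1] -/
theorem colorSwap (h : ZXStep D E) : ZXStep D.colorSwap E.colorSwap := by
  induction h with
  | rule h => exact .rule h.colorSwap
  | rule_symm h => exact .rule_symm h.colorSwap
  | seq_left B _ ih => exact .seq_left B.colorSwap ih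
  | seq_right A _ ih => exact .seq_right A.colorSwap ih
  | par_left B _ ih => exact .par_left B.colorSwap ih
  | par_right A _ ih => exact .par_right A.colorSwap ih

/-- Rewrite steps transport along casts. [folklore] -/
theorem cast (h : ZXStep D E) (hn : n = n') (hm : m = m') : ZXStep (D.cast hn hm) (E.cast hn hm) := by
  subst hn hm; exact h

end ZXStep

/-! ### Transporting derivations through step-preserving maps -/

namespace ZXDerivation

/-- Transport of a derivation along a map of diagrams that preserves single steps (e.g. a one-hole
context, the flip, the colour swap), step by step. [cite: JeandelPerdrixVilmart2018, §2.2] -/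
def map (f : ZXDiagram n m → ZXDiagram n' m')
    (hf : ∀ {A A' : ZXDiagram n m}, ZXStep A A' → ZXStep (f A) (f A')) :
    {D E : ZXDiagram n m} → ZXDerivation D E → ZXDerivation (f D) (f E)
  | _, _, .refl D => .refl (f D)
  | _, _, .tail d h => .tail (map f hf d) (hf h)

/-- Transport preserves the length. [folklore] -/
@[simp] theorem length_map (f : ZXDiagram n m → ZXDiagram n' m')
    (hf : ∀ {A A' : ZXDiagram n m}, ZXStep A A' → ZXStep (f A) (f A')) :
    {D E : ZXDiagram n m} → (d : ZXDerivation D E) → (d.map f hf).length = d.length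
  | _, _, .refl _ => by simp [map]
  | _, _, .tail d h => by simp [map, length_map f hf d]

end ZXDerivation

/-! ### `ZXDerives`: length-preserving congruence and symmetries -/

namespace ZXDerives

variable {D E : ZXDiagram n m} {ℓ : ℕ}

/-- Transport of `ℓ`-step derivability along a step-preserving map. [folklore] -/
theorem map (f : ZXDiagram n m → ZXDiagram n' m')
    (hf : ∀ {A A' : ZXDiagram n m}, ZXStep A A' → ZXStep (f A) (f A')) (h : ZXDerives D E ℓ) :
    ZXDerives (f D) (f E) ℓ := by
  obtain ⟨d, rfl⟩ := h
  exact ⟨d.map f hf, d.length_map f hf⟩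

/-- Rewriting the first factor of a sequential composition, same length. [cite: JeandelPerdrixVilmart2018, §2.2] -/
theorem seq_left (B : ZXDiagram m k) (h : ZXDerives D E ℓ) : ZXDerives (D ⨾ B) (E ⨾ B) ℓ :=
  h.map (fun A => A ⨾ B) (ZXStep.seq_left B)

/-- Rewriting the second factor of a sequential composition, same length. [cite: JeandelPerdrixVilmart2018, §2.2] -/
theorem seq_right (A : ZXDiagram k n) (h : ZXDerives D E ℓ) : ZXDerives (A ⨾ D) (A ⨾ E) ℓ :=
  h.map (fun B => A ⨾ B) (ZXStep.seq_right A)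

/-- Rewriting the first factor of a spatial composition, same length. [cite: JeandelPerdrixVilmart2018, §2.2] -/
theorem par_left (B : ZXDiagram n' m') (h : ZXDerives D E ℓ) : ZXDerives (D ⊗ B) (E ⊗ B) ℓ :=
  h.map (fun A => A ⊗ B) (ZXStep.par_left B)

/-- Rewriting the second factor of a spatial composition, same length. [cite: JeandelPerdrixVilmart2018, §2.2] -/
theorem par_right (A : ZXDiagram n' m') (h : ZXDerives D E ℓ) : ZXDerives (A ⊗ D) (A ⊗ E) ℓ :=
  h.map (fun B => A ⊗ B) (ZXStep.par_right A)

/-- Both factors of a sequential composition, lengths add. [folklore] -/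
theorem seq_congr {A A' : ZXDiagram n m} {B B' : ZXDiagram m k} {ℓ₁ ℓ₂ : ℕ} (hA : ZXDerives A A' ℓ₁)
    (hB : ZXDerives B B' ℓ₂) : ZXDerives (A ⨾ B) (A' ⨾ B') (ℓ₁ + ℓ₂) :=
  (hA.seq_left B).trans (hB.seq_right A')

/-- Both factors of a spatial composition, lengths add. [folklore] -/
theorem par_congr {A A' : ZXDiagram n m} {B B' : ZXDiagram n' m'} {ℓ₁ ℓ₂ : ℕ} (hA : ZXDerives A A' ℓ₁)
    (hB : ZXDerives B B' ℓ₂) : ZXDerives (A ⊗ B) (A' ⊗ B') (ℓ₁ + ℓ₂) :=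
  (hA.par_left B).trans (hB.par_right A')

/-- The upside-down flip of a derivation, same length. [cite: JeandelPerdrixVilmart2018, §10] -/
theorem transpose (h : ZXDerives D E ℓ) : ZXDerives D.transpose E.transpose ℓ :=
  h.map ZXDiagram.transpose ZXStep.transpose

/-- The colour swap of a derivation, same length. [cite: JeandelPerdrixVilmart2018, §10] -/
theorem colorSwap (h : ZXDerives D E ℓ) : ZXDerives D.colorSwap E.colorSwap ℓ :=
  h.map ZXDiagram.colorSwap ZXStep.colorSwap

/-- Derivability of the flips is derivability, with the same length. [folklore] -/
theorem transpose_iff : ZXDerives D.transpose E.transpose ℓ ↔ ZXDerives D E ℓ :=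
  ⟨fun h => by simpa only [transpose_transpose] using h.transpose, transpose⟩

/-- Derivability of the colour swaps is derivability, with the same length. [folklore] -/
theorem colorSwap_iff : ZXDerives D.colorSwap E.colorSwap ℓ ↔ ZXDerives D E ℓ :=
  ⟨fun h => by simpa only [colorSwap_colorSwap] using h.colorSwap, colorSwap⟩

/-- Derivability transports along casts. [folklore] -/
theorem cast (h : ZXDerives D E ℓ) (hn : n = n') (hm : m = m') :
    ZXDerives (D.cast hn hm) (E.cast hn hm) ℓ := by
  subst hn hm; exact h

/-- A rule, left to right, is a derivation of length one. [folklore] -/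
theorem of_rule (h : Rule D E) : ZXDerives D E 1 := (ZXStep.rule h).derives

/-- A rule, right to left, is a derivation of length one. [folklore] -/
theorem of_rule_symm (h : Rule D E) : ZXDerives E D 1 := (ZXStep.rule_symm h).derives

end ZXDerives

/-! ### `ZXEquivalent`: an equivalence relation and a congruence containing the rules -/

/-- `D ⇌ D'`: the diagrams `D`, `D'` are inter-derivable in `ZX_{π/4}` (`ZXEquivalent`, JPV's
`ZX_{π/4} ⊢ D = D'`). [cite: JeandelPerdrixVilmart2018, §2.2] -/
scoped[Literature.Computability.QuantumComplexity] notation:50 D:51 " ⇌ " D':51 => ZXEquivalent D D'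

namespace ZXEquivalent

variable {D E F : ZXDiagram n m}

/-- From `ℓ`-step derivability. [folklore] -/
theorem of_derives {ℓ : ℕ} (h : ZXDerives D E ℓ) : D ⇌ E := ⟨ℓ, h⟩

/-- Reflexivity. [cite: JeandelPerdrixVilmart2018, §2.2] -/
protected theorem refl (D : ZXDiagram n m) : D ⇌ D := ⟨0, ZXDerives.refl D⟩

/-- Reflexivity. [folklore] -/
protected theorem rfl : D ⇌ D := .refl D

/-- Symmetry (the axioms are equations). [cite: JeandelPerdrixVilmart2018, §2.2] -/
protected theorem symm (h : D ⇌ E) : E ⇌ D := by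
  obtain ⟨ℓ, h⟩ := h; exact ⟨ℓ, h.symm⟩

/-- Transitivity. [cite: JeandelPerdrixVilmart2018, §2.2] -/
protected theorem trans (h₁ : D ⇌ E) (h₂ : E ⇌ F) : D ⇌ F := by
  obtain ⟨ℓ₁, h₁⟩ := h₁; obtain ⟨ℓ₂, h₂⟩ := h₂; exact ⟨ℓ₁ + ℓ₂, h₁.trans h₂⟩

/-- A single rewrite step. [folklore] -/
theorem of_step (h : ZXStep D E) : D ⇌ E := ⟨1, h.derives⟩

/-- Transport along a step-preserving map of diagrams. [folklore] -/
theorem map (f : ZXDiagram n m → ZXDiagram n' m')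
    (hf : ∀ {A A' : ZXDiagram n m}, ZXStep A A' → ZXStep (f A) (f A')) (h : D ⇌ E) : f D ⇌ f E := by
  obtain ⟨ℓ, h⟩ := h; exact ⟨ℓ, h.map f hf⟩

/-- Congruence: first factor of `⨾`. [cite: JeandelPerdrixVilmart2018, §2.2] -/
theorem seq_left (B : ZXDiagram m k) (h : D ⇌ E) : D ⨾ B ⇌ E ⨾ B := h.map _ (ZXStep.seq_left B)

/-- Congruence: second factor of `⨾`. [cite: JeandelPerdrixVilmart2018, §2.2] -/
theorem seq_right (A : ZXDiagram k n) (h : D ⇌ E) : A ⨾ D ⇌ A ⨾ E := h.map _ (ZXStep.seq_right A)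

/-- Congruence: first factor of `⊗`. [cite: JeandelPerdrixVilmart2018, §2.2] -/
theorem par_left (B : ZXDiagram n' m') (h : D ⇌ E) : D ⊗ B ⇌ E ⊗ B := h.map _ (ZXStep.par_left B)

/-- Congruence: second factor of `⊗`. [cite: JeandelPerdrixVilmart2018, §2.2] -/
theorem par_right (A : ZXDiagram n' m') (h : D ⇌ E) : A ⊗ D ⇌ A ⊗ E := h.map _ (ZXStep.par_right A)

/-- Congruence: both factors of `⨾`. [cite: JeandelPerdrixVilmart2018, §2.2] -/
theorem seq_congr {A A' : ZXDiagram n m} {B B' : ZXDiagram m k} (hA : A ⇌ A') (hB : B ⇌ B') :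
    A ⨾ B ⇌ A' ⨾ B' :=
  (hA.seq_left B).trans (hB.seq_right A')

/-- Congruence: both factors of `⊗`. [cite: JeandelPerdrixVilmart2018, §2.2] -/
theorem par_congr {A A' : ZXDiagram n m} {B B' : ZXDiagram n' m'} (hA : A ⇌ A') (hB : B ⇌ B') :
    A ⊗ B ⇌ A' ⊗ B' :=
  (hA.par_left B).trans (hB.par_right A')

/-- The upside-down flip of an equation. [cite: JeandelPerdrixVilmart2018, §10] -/
theorem transpose (h : D ⇌ E) : D.transpose ⇌ E.transpose := h.map _ ZXStep.transpose

/-- The colour swap of an equation. [cite: JeandelPerdrixVilmart2018, §10] -/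
theorem colorSwap (h : D ⇌ E) : D.colorSwap ⇌ E.colorSwap := h.map _ ZXStep.colorSwap

/-- An equation holds iff its upside-down flip holds. [cite: JeandelPerdrixVilmart2018, §10] -/
theorem transpose_iff : D.transpose ⇌ E.transpose ↔ D ⇌ E :=
  ⟨fun h => by simpa only [transpose_transpose] using h.transpose, transpose⟩

/-- An equation holds iff its colour swap holds. [cite: JeandelPerdrixVilmart2018, §2.2] -/
theorem colorSwap_iff : D.colorSwap ⇌ E.colorSwap ↔ D ⇌ E :=
  ⟨fun h => by simpa only [colorSwap_colorSwap] using h.colorSwap, colorSwap⟩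

/-- Equations between flipped diagrams, stated with the flip on one side. [folklore] -/
theorem transpose_left_iff {E' : ZXDiagram m n} : D.transpose ⇌ E' ↔ D ⇌ E'.transpose := by
  rw [← transpose_iff, transpose_transpose]

/-- Equations between colour-swapped diagrams, stated with the swap on one side. [folklore] -/
theorem colorSwap_left_iff {E' : ZXDiagram n m} : D.colorSwap ⇌ E' ↔ D ⇌ E'.colorSwap := by
  rw [← colorSwap_iff, colorSwap_colorSwap]

/-- Equations transport along casts. [folklore] -/
theorem cast (h : D ⇌ E) (hn : n = n') (hm : m = m') : D.cast hn hm ⇌ E.cast hn hm := by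
  subst hn hm; exact h

/-- An equation between casts is an equation. [folklore] -/
theorem cast_iff (hn : n = n') (hm : m = m') : D.cast hn hm ⇌ E.cast hn hm ↔ D ⇌ E := by
  subst hn hm; exact Iff.rfl

/-- Moving a cast to the other side of an equation. [folklore] -/
theorem cast_left_iff {E' : ZXDiagram n' m'} (hn : n = n') (hm : m = m') :
    D.cast hn hm ⇌ E' ↔ D ⇌ E'.cast hn.symm hm.symm := by
  subst hn hm; exact Iff.rfl

end ZXEquivalent

/-- Inter-derivability as a setoid on diagrams of a fixed type. [folklore] -/
instance ZXDiagram.instSetoid (n m : ℕ) : Setoid (ZXDiagram n m) where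
  r := ZXEquivalent
  iseqv := ⟨ZXEquivalent.refl, ZXEquivalent.symm, ZXEquivalent.trans⟩

/-- `calc` support: chaining two equations. [folklore] -/
instance : Trans (@ZXEquivalent n m) (@ZXEquivalent n m) (@ZXEquivalent n m) := ⟨ZXEquivalent.trans⟩

/-- `calc` support: an equation followed by a step. [folklore] -/
instance : Trans (@ZXEquivalent n m) (@ZXStep n m) (@ZXEquivalent n m) :=
  ⟨fun h h' => h.trans (ZXEquivalent.of_step h')⟩

/-- `calc` support: a step followed by an equation. [folklore] -/
instance : Trans (@ZXStep n m) (@ZXEquivalent n m) (@ZXEquivalent n m) :=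
  ⟨fun h h' => (ZXEquivalent.of_step h).trans h'⟩

namespace ZXDiagram.Rule

variable {l r : ZXDiagram n m}

/-- Every axiom, left to right, is an equation of `ZX_{π/4}`. [cite: JeandelPerdrixVilmart2018, §2.2] -/
theorem zx (h : Rule l r) : l ⇌ r := ZXEquivalent.of_step (.rule h)

/-- Every axiom, right to left, is an equation of `ZX_{π/4}`. [cite: JeandelPerdrixVilmart2018, §2.2] -/
theorem zx_symm (h : Rule l r) : r ⇌ l := ZXEquivalent.of_step (.rule_symm h)

end ZXDiagram.Rule

end Literature.Computability.QuantumComplexity
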